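import Summits.RiemannHypothesis.RiemannHypothesis.Theorems.WeilFormatCTailEvenJMS
import Summits.RiemannHypothesis.RiemannHypothesis.Theorems.WeilFormatCTailJJMatrixAlgebra
import HarnessLib

/-!
# Format C (even sector): the COMPRESSED EXACT MIDDLE — design "MJ"

Route context: Fourier–Galerkin / Schur-complement certificates of Weil positivity on a window ("format C";
cell memo `run/shared/lean/pub/rh-explicit/rh-explicit-weil-10/FORMATC-DESIGN.md` §9.10; supporting
stmt-RiemannHypothesis-0098; seat rh-explicit-weil-10).  Between the exact columns `[B, B₃)` (`B₃ ≥ 2B`) and the analytic tail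
the structured column decomposition of `WeilFormatCColumnKernel` / `abs_evenKernel_col_sub_families_le` is EXACT up to the
order-`J` remainder; summing `(b_m·x)²/w_m` over a FINITE middle range `[B₃, B₄)` with per-mode weights `0 < w_m ≤ d_m` therefore
needs no estimate beyond ONE Peter–Paul step: the structured part is the quadratic form of the `(2J)×(2J)` Gram of the EXACT mode
values `(F_m/π)m^{-e^A_j}`, `m^{-e^B_r}` (four `J×J` blocks, finite sums the data seat encloses from the light table), the
remainder a diagonal.  Kernel cost per middle column: `(2J)²` products instead of `B²/2` — the production lever for the odd parity
(PRODUCTION-TABLE-v2.md §3).  The conclusion is literally the `hUmid` premise of `weilPositivityOn_of_formatC_pieces`.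

* `even_middleJ_majorant_matrix`.

Standard axioms; no definitions; no RH claim.
-/

set_option autoImplicit false
-- `Summit.RiemannHypothesis.RiemannHypothesis.…` is the layout-mandated namespace (summit = problem name).
set_option linter.dupNamespace false

noncomputable section

open Complex Finset Matrix
open scoped Real BigOperators ArithmeticFunction.vonMangoldt

namespace Summit.RiemannHypothesis.RiemannHypothesis.Theorems.WeilFormatC

open Literature.NumberTheory.LFunctions Literature.NumberTheory.LFunctions.Yoshida1992
open Literature.Analysis.SpecialFunctions

variable {a : ℝ}

/-! ## Algebra of the compressed middle -/

section MiddleAlgebra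

/-- Moving the mode factor and the powers inside: `F/π·Σ_j α_j/m^{e_j} + Σ_r β_r/m^{e'_r} = Σ_j α_j(F/π/m^{e_j}) + Σ_r β_r(1/m^{e'_r})`. -/
theorem modePoly_eq_sum_mul {DA DB : ℕ} (F c : ℝ) (m : ℝ) (eA : Fin DA → ℕ) (eB : Fin DB → ℕ)
    (α : Fin DA → ℝ) (β : Fin DB → ℝ) :
    F / c * (∑ j, α j / m ^ eA j) + ∑ r', β r' / m ^ eB r'
      = (∑ j, α j * (F / c / m ^ eA j)) + ∑ r', β r' * (1 / m ^ eB r') := by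
  rw [Finset.mul_sum]
  congr 1
  · exact Finset.sum_congr rfl fun j _ ↦ by ring
  · exact Finset.sum_congr rfl fun r' _ ↦ by ring

/-- **Bilinear expansion of a weighted sum of squares of a two-family linear form** (finite, exact):
`Σ_{m∈T} (Σ_j α_j f_j(m) + Σ_r β_r g_r(m))²/c_m` as four blocks with entries `Σ_m f f'/c`, `Σ_m f g/c`, `Σ_m g f/c`, `Σ_m g g'/c`. -/
theorem sum_sq_add_div_eq {DA DB : ℕ} (T : Finset ℕ) (f : Fin DA → ℕ → ℝ) (g : Fin DB → ℕ → ℝ) (c : ℕ → ℝ)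
    (α : Fin DA → ℝ) (β : Fin DB → ℝ) :
    ∑ m ∈ T, ((∑ j, α j * f j m) + ∑ r', β r' * g r' m) ^ 2 / c m
      = (((∑ j, ∑ j', α j * α j' * (∑ m ∈ T, f j m * f j' m / c m))
          + ∑ j, ∑ r', α j * β r' * (∑ m ∈ T, f j m * g r' m / c m))
        + ((∑ r', ∑ j, β r' * α j * (∑ m ∈ T, g r' m * f j m / c m))
          + ∑ r', ∑ r'', β r' * β r'' * (∑ m ∈ T, g r' m * g r'' m / c m))) := by
  have hexp : ∀ m ∈ T, ((∑ j, α j * f j m) + ∑ r', β r' * g r' m) ^ 2 / c m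
      = ((∑ j, ∑ j', α j * α j' * (f j m * f j' m / c m))
          + ∑ j, ∑ r', α j * β r' * (f j m * g r' m / c m))
        + ((∑ r', ∑ j, β r' * α j * (g r' m * f j m / c m))
          + ∑ r', ∑ r'', β r' * β r'' * (g r' m * g r'' m / c m)) := by
    intro m _
    rw [sq, add_mul, mul_add, mul_add, add_div, add_div, add_div]
    simp only [Finset.sum_mul_sum, Finset.sum_div]
    congr 1 <;> congr 1 <;>
      exact Finset.sum_congr rfl fun _ _ ↦ Finset.sum_congr rfl fun _ _ ↦ by ring
  rw [Finset.sum_congr rfl hexp]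
  simp only [Finset.sum_add_distrib]
  congr 1 <;> congr 1 <;>
    (rw [Finset.sum_comm]; refine Finset.sum_congr rfl fun _ _ ↦ ?_; rw [Finset.sum_comm];
     refine Finset.sum_congr rfl fun _ _ ↦ ?_; rw [Finset.mul_sum])

/-- The skeleton of the middle bound as a quadratic form: four Gram blocks and the remainder diagonal. -/
theorem sum_sum_mul_skeletonMJ_eq {B : ℕ} (x : Fin B → ℝ) (k s t : ℝ) (T1 T2 T3 T4 : Fin B → Fin B → ℝ) (c : Fin B → ℝ) :
    ∑ i, ∑ i', x i * x i' * (k * ((T1 i i' + T2 i i') + (T3 i i' + T4 i i')) + (if i = i' then s * c i * t else 0))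
      = k * ((((∑ i, ∑ i', x i * x i' * T1 i i') + ∑ i, ∑ i', x i * x i' * T2 i i')
          + ((∑ i, ∑ i', x i * x i' * T3 i i') + ∑ i, ∑ i', x i * x i' * T4 i i')))
        + s * (∑ i, c i * x i ^ 2) * t := by
  have h : ∀ i i', x i * x i' * (k * ((T1 i i' + T2 i i') + (T3 i i' + T4 i i')) + (if i = i' then s * c i * t else 0))
      = k * (x i * x i' * T1 i i') + k * (x i * x i' * T2 i i') + k * (x i * x i' * T3 i i') + k * (x i * x i' * T4 i i')
        + x i * x i' * (if i = i' then s * c i * t else 0) := by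
    intro i i'; ring
  simp only [h, Finset.sum_add_distrib, ← Finset.mul_sum]
  have hite : ∑ i, ∑ i', x i * x i' * (if i = i' then s * c i * t else 0) = s * (∑ i, c i * x i ^ 2) * t := by
    rw [Finset.mul_sum, Finset.sum_mul]
    refine Finset.sum_congr rfl fun i _ ↦ ?_
    simp only [mul_ite, mul_zero, Finset.sum_ite_eq, Finset.mem_univ, if_true]
    ring
  rw [hite]
  ring

end MiddleAlgebra

/-! ## The middle majorant -/

section Middle

/-- **Even-sector compressed exact middle** — see the module docstring. -/
theorem even_middleJ_majorant_matrix (ha : 0 < a) {B B₃ B₄ : ℕ} (hB : 1 ≤ B) (hBB : 2 * B ≤ B₃) (J : ℕ)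
    (d w : ℕ → ℝ) (hw : ∀ m, B₃ ≤ m → m < B₄ → 0 < w m ∧ w m ≤ d m) {θ : ℝ} (hθ : 0 < θ) (x : Fin B → ℝ) :
    ∑ m ∈ Finset.Ico B₃ B₄, (∑ i : Fin B,
        (if (i : ℕ) = 0 then gramCoeff a 0 m else if m = 0 then gramCoeff a i 0
          else (gramCoeff a i m + gramCoeff a i (-(m : ℤ))) / 2) * x i) ^ 2 / d m
      ≤ x ⬝ᵥ (Matrix.of fun i i' : Fin B ↦
          (1 + θ) * (((∑ j : Fin J, ∑ j' : Fin J, (∑ m ∈ Finset.Ico B₃ B₄, (((Complex.digamma (1 / 4 + ((freq a m : ℝ) : ℂ) / 2 * I)).im / 2 + (∑ k ∈ weilPrimeIndex a, (Λ k : ℝ) / Real.sqrt k * Real.sin (freq a m * Real.log k)) - archExpSumSin a m) / π / (m : ℝ) ^ (2 * (j : ℕ) + 1)) * (((Complex.digamma (1 / 4 + ((freq a m : ℝ) : ℂ) / 2 * I)).im / 2 + (∑ k ∈ weilPrimeIndex a, (Λ k : ℝ) / Real.sqrt k * Real.sin (freq a m * Real.log k)) - archExpSumSin a m) / π / (m :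 ℝ) ^ (2 * (j' : ℕ) + 1)) / w m) * ((-1 : ℝ) ^ (i : ℕ) * (i : ℝ) ^ (2 * (j : ℕ))) * ((-1 : ℝ) ^ (i' : ℕ) * (i' : ℝ) ^ (2 * (j' : ℕ))))
            + ∑ j : Fin J, ∑ r' : Fin J, (∑ m ∈ Finset.Ico B₃ B₄, (((Complex.digamma (1 / 4 + ((freq a m : ℝ) : ℂ) / 2 * I)).im / 2 + (∑ k ∈ weilPrimeIndex a, (Λ k : ℝ) / Real.sqrt k * Real.sin (freq a m * Real.log k)) - archExpSumSin a m) / π / (m : ℝ) ^ (2 * (j : ℕ) + 1)) * (1 / (m : ℝ) ^ (2 * (r' : ℕ) + 2)) / w m) * ((-1 : ℝ) ^ (i : ℕ) * (i : ℝ) ^ (2 * (j : ℕ))) * ((-1 : ℝ) ^ (i' : ℕ) * (-((i' : ℝ) ^ (2 * (r' : ℕ) + 1)) * ((Complex.digamma (1 / 4 + ((freq a i' : ℝ) : ℂ) / 2 * I)).im / 2 + (∑ k ∈ weilPrimeIndex a, (Λ k : ℝ) / Real.sqrt k * Real.sin (freq a i' * Real.log k)) - archExpSumSin a i') / π + 4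 / a * (Real.exp (a / 2) - Real.exp (-(a / 2))) ^ 2 * (-1 : ℝ) ^ (r' : ℕ) * (a ^ 2 / (4 * π ^ 2)) ^ ((r' : ℕ) + 1) * (1 / (1 + 4 * freq a i' ^ 2)))))
          + ((∑ r' : Fin J, ∑ j : Fin J, (∑ m ∈ Finset.Ico B₃ B₄, (1 / (m : ℝ) ^ (2 * (r' : ℕ) + 2)) * (((Complex.digamma (1 / 4 + ((freq a m : ℝ) : ℂ) / 2 * I)).im / 2 + (∑ k ∈ weilPrimeIndex a, (Λ k : ℝ) / Real.sqrt k * Real.sin (freq a m * Real.log k)) - archExpSumSin a m) / π / (m : ℝ) ^ (2 * (j : ℕ) + 1)) / w m) * ((-1 : ℝ) ^ (i : ℕ) * (-((i : ℝ) ^ (2 * (r' : ℕ) + 1)) * ((Complex.digamma (1 / 4 + ((freq a i : ℝ) : ℂ) / 2 * I)).im / 2 + (∑ k ∈ weilPrimeIndex a, (Λ k : ℝ) / Real.sqrt k * Real.sin (freq a i * Real.log k)) - archExpSumSin a i) / π + 4 / a * (Real.exp (a / 2) - Real.exp (-(a / 2))) ^ 2 * (-1 : ℝ) ^ (r' : ℕ)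 * (a ^ 2 / (4 * π ^ 2)) ^ ((r' : ℕ) + 1) * (1 / (1 + 4 * freq a i ^ 2)))) * ((-1 : ℝ) ^ (i' : ℕ) * (i' : ℝ) ^ (2 * (j : ℕ))))
            + ∑ r' : Fin J, ∑ r'' : Fin J, (∑ m ∈ Finset.Ico B₃ B₄, (1 / (m : ℝ) ^ (2 * (r' : ℕ) + 2)) * (1 / (m : ℝ) ^ (2 * (r'' : ℕ) + 2)) / w m) * ((-1 : ℝ) ^ (i : ℕ) * (-((i : ℝ) ^ (2 * (r' : ℕ) + 1)) * ((Complex.digamma (1 / 4 + ((freq a i : ℝ) : ℂ) / 2 * I)).im / 2 + (∑ k ∈ weilPrimeIndex a, (Λ k : ℝ) / Real.sqrt k * Real.sin (freq a i * Real.log k)) - archExpSumSin a i) / π + 4 / a * (Real.exp (a / 2) - Real.exp (-(a / 2))) ^ 2 * (-1 : ℝ) ^ (r' : ℕ) * (a ^ 2 / (4 * π ^ 2)) ^ ((r' : ℕ) + 1) * (1 / (1 + 4 * freq a i ^ 2)))) * ((-1 : ℝ) ^ (i' : ℕ) * (-((i' : ℝ) ^ (2 * (r'' : ℕ) + 1))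 * ((Complex.digamma (1 / 4 + ((freq a i' : ℝ) : ℂ) / 2 * I)).im / 2 + (∑ k ∈ weilPrimeIndex a, (Λ k : ℝ) / Real.sqrt k * Real.sin (freq a i' * Real.log k)) - archExpSumSin a i') / π + 4 / a * (Real.exp (a / 2) - Real.exp (-(a / 2))) ^ 2 * (-1 : ℝ) ^ (r'' : ℕ) * (a ^ 2 / (4 * π ^ 2)) ^ ((r'' : ℕ) + 1) * (1 / (1 + 4 * freq a i' ^ 2))))))
        + (if i = i' then (1 + θ⁻¹) * (B : ℝ) * ((2 * (π / 4 + (∑ k ∈ weilPrimeIndex a, (Λ k : ℝ) / Real.sqrt k) + a * (1 + weilArchDensity (2 * a)) / π) * (i : ℝ) ^ (2 * J) / π + 4 / a * (Real.exp (a / 2) - Real.exp (-(a / 2))) ^ 2 * (a ^ 2 / (4 * π ^ 2)) ^ (J + 1) * (1 / (1 + 4 * freq a i ^ 2)))) ^ 2 * (∑ m ∈ Finset.Ico B₃ B₄, (1 / ((m : ℝ) ^ (2 * J + 1))) ^ 2 / w m) else 0)) *ᵥ x := by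
  -- abbreviations
  set T := Finset.Ico B₃ B₄ with hT
  have hB₃ : 2 ≤ B₃ := by omega
  have hB₃1 : 1 ≤ B₃ := by omega
  have hB0 : (0 : ℝ) < B := by exact_mod_cast hB
  set Fmode : ℕ → ℝ := fun n ↦ (Complex.digamma (1 / 4 + ((freq a n : ℝ) : ℂ) / 2 * I)).im / 2
      + (∑ k ∈ weilPrimeIndex a, (Λ k : ℝ) / Real.sqrt k * Real.sin (freq a n * Real.log k)) - archExpSumSin a n
    with hFmode
  set kP : ℝ := 4 / a * (Real.exp (a / 2) - Real.exp (-(a / 2))) ^ 2 with hkP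
  set q : ℝ := a ^ 2 / (4 * π ^ 2) with hq
  set cfac : ℕ → ℝ := fun n ↦ 1 / (1 + 4 * freq a n ^ 2) with hcfac
  -- row functionals
  set vA : Fin J → Fin B → ℝ := fun j i ↦ (-1 : ℝ) ^ (i : ℕ) * (i : ℝ) ^ (2 * (j : ℕ)) with hvA
  set vB : Fin J → Fin B → ℝ := fun r i ↦ (-1 : ℝ) ^ (i : ℕ) *
      (-((i : ℝ) ^ (2 * (r : ℕ) + 1)) * Fmode i / π + kP * (-1 : ℝ) ^ (r : ℕ) * q ^ ((r : ℕ) + 1) * cfac i) with hvB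
  set αA : Fin J → ℝ := fun j ↦ ∑ i, vA j i * x i with hαA
  set αB : Fin J → ℝ := fun r ↦ ∑ i, vB r i * x i with hαB
  set ρ : Fin B → ℝ := fun i ↦ (2 * (π / 4 + (∑ k ∈ weilPrimeIndex a, (Λ k : ℝ) / Real.sqrt k)
        + a * (1 + weilArchDensity (2 * a)) / π) * (i : ℝ) ^ (2 * J) / π + kP * q ^ (J + 1) * cfac i) with hρ
  set bcol : ℕ → Fin B → ℝ := fun m i ↦
    (if (i : ℕ) = 0 then gramCoeff a 0 m else if m = 0 then gramCoeff a i 0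
      else (gramCoeff a i m + gramCoeff a i (-(m : ℤ))) / 2) with hbcol
  -- per-mode facts
  have hTm : ∀ m ∈ T, B₃ ≤ m := fun m hm ↦ (Finset.mem_Ico.mp hm).1
  have key : ∀ m ∈ T, (∑ i, bcol m i * x i) ^ 2 / d m
      ≤ (1 + θ) * ((Fmode m / π * (∑ j, αA j / (m : ℝ) ^ (2 * (j : ℕ) + 1)) + (∑ r, αB r / (m : ℝ) ^ (2 * (r : ℕ) + 2))) ^ 2 / w m)
        + (1 + θ⁻¹) * (B : ℝ) * (∑ i, ρ i ^ 2 * x i ^ 2) * ((1 / ((m : ℝ) ^ (2 * J + 1))) ^ 2 / w m) := by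
    intro m hm
    have hmT := Finset.mem_Ico.mp hm
    have hmB := hmT.1
    have hm1 : 1 ≤ m := le_trans hB₃1 hmB
    have hm0 : (0 : ℝ) < m := by exact_mod_cast hm1
    have hwm := hw m hmT.1 hmT.2
    have hwpos : 0 < w m := hwm.1
    have hdpos : 0 < d m := lt_of_lt_of_le hwpos hwm.2
    -- decomposition of the column sum
    set R : ℝ := ∑ i, (bcol m i - (-1 : ℝ) ^ m *
        (Fmode m / π * ∑ j ∈ Finset.range J, ((-1 : ℝ) ^ (i : ℕ) * (i : ℝ) ^ (2 * j)) / (m : ℝ) ^ (2 * j + 1)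
          + ∑ r ∈ Finset.range J, ((-1 : ℝ) ^ (i : ℕ) *
              (-((i : ℝ) ^ (2 * r + 1)) * Fmode i / π + kP * (-1 : ℝ) ^ r * q ^ (r + 1) * cfac i)) / (m : ℝ) ^ (2 * r + 2)))
        * x i with hR
    have hsplit : ∑ i, bcol m i * x i = (-1 : ℝ) ^ m * (Fmode m / π * (∑ j, αA j / (m : ℝ) ^ (2 * (j : ℕ) + 1)) + (∑ r, αB r / (m : ℝ) ^ (2 * (r : ℕ) + 2))) + R := by
      have ePA : (∑ j, αA j / (m : ℝ) ^ (2 * (j : ℕ) + 1)) = ∑ i : Fin B, (∑ j ∈ Finset.range J, ((-1 : ℝ) ^ (i : ℕ) * (i : ℝ) ^ (2 * j)) / (m : ℝ) ^ (2 * j + 1)) * x i := by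
        simp only [hαA, hvA, Finset.sum_div]
        rw [Finset.sum_comm]
        refine Finset.sum_congr rfl fun i _ ↦ ?_
        rw [Finset.sum_mul, Finset.sum_range]
        refine Finset.sum_congr rfl fun j _ ↦ by ring
      have ePB : (∑ r, αB r / (m : ℝ) ^ (2 * (r : ℕ) + 2)) = ∑ i : Fin B, (∑ r ∈ Finset.range J, ((-1 : ℝ) ^ (i : ℕ) *
          (-((i : ℝ) ^ (2 * r + 1)) * Fmode i / π + kP * (-1 : ℝ) ^ r * q ^ (r + 1) * cfac i)) / (m : ℝ) ^ (2 * r + 2)) * x i := by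
        simp only [hαB, hvB, Finset.sum_div]
        rw [Finset.sum_comm]
        refine Finset.sum_congr rfl fun i _ ↦ ?_
        rw [Finset.sum_mul, Finset.sum_range]
        refine Finset.sum_congr rfl fun r _ ↦ by ring
      rw [ePA, ePB, hR, Finset.mul_sum, mul_add, Finset.mul_sum, Finset.mul_sum, ← Finset.sum_add_distrib,
        ← Finset.sum_add_distrib]
      refine Finset.sum_congr rfl fun i _ ↦ by ring
    have hRle : |R| ≤ ∑ i, ρ i / (m : ℝ) ^ (2 * J + 1) * |x i| := by
      refine (Finset.abs_sum_le_sum_abs _ _).trans (Finset.sum_le_sum fun i _ ↦ ?_)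
      rw [abs_mul]
      refine mul_le_mul_of_nonneg_right ?_ (abs_nonneg _)
      have him : 2 * (i : ℕ) ≤ m := by have := i.isLt; omega
      have h := abs_evenKernel_col_sub_families_le ha hm1 him J
      simp only [hbcol, hFmode, hkP, hq, hcfac, hρ]
      exact h
    have hRsq : R ^ 2 ≤ (B : ℝ) * (∑ i, ρ i ^ 2 * x i ^ 2) * (1 / ((m : ℝ) ^ (2 * J + 1)) ^ 2) := by
      have h := sq_sum_mul_le_card_mul (ι := Fin B)
        (fun i ↦ (bcol m i - (-1 : ℝ) ^ m *
          (Fmode m / π * ∑ j ∈ Finset.range J, ((-1 : ℝ) ^ (i : ℕ) * (i : ℝ) ^ (2 * j)) / (m : ℝ) ^ (2 * j + 1)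
            + ∑ r ∈ Finset.range J, ((-1 : ℝ) ^ (i : ℕ) *
                (-((i : ℝ) ^ (2 * r + 1)) * Fmode i / π + kP * (-1 : ℝ) ^ r * q ^ (r + 1) * cfac i)) / (m : ℝ) ^ (2 * r + 2))))
        (fun i ↦ ρ i / (m : ℝ) ^ (2 * J + 1)) x (fun i ↦ by
          have him : 2 * (i : ℕ) ≤ m := by have := i.isLt; omega
          have h := abs_evenKernel_col_sub_families_le ha hm1 him J
          simp only [hbcol, hFmode, hkP, hq, hcfac, hρ]
          exact h)
      simp only [Fintype.card_fin] at h
      refine h.trans (le_of_eq ?_)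
      rw [mul_assoc, Finset.sum_mul]
      congr 1
      refine Finset.sum_congr rfl fun i _ ↦ ?_
      rw [div_pow]
      ring
    -- assemble: square, ONE Peter–Paul in θ, divide by w ≤ d
    have hsq : (∑ i, bcol m i * x i) ^ 2
        ≤ (1 + θ) * (Fmode m / π * (∑ j, αA j / (m : ℝ) ^ (2 * (j : ℕ) + 1)) + (∑ r, αB r / (m : ℝ) ^ (2 * (r : ℕ) + 2))) ^ 2
          + (1 + θ⁻¹) * ((B : ℝ) * (∑ i, ρ i ^ 2 * x i ^ 2) * (1 / ((m : ℝ) ^ (2 * J + 1)) ^ 2)) := by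
      rw [hsplit]
      have hpp := sq_add_le_peterPaul (p := (-1 : ℝ) ^ m * (Fmode m / π * (∑ j, αA j / (m : ℝ) ^ (2 * (j : ℕ) + 1)) + (∑ r, αB r / (m : ℝ) ^ (2 * (r : ℕ) + 2)))) (q := R) hθ
      have hsgn : ((-1 : ℝ) ^ m * (Fmode m / π * (∑ j, αA j / (m : ℝ) ^ (2 * (j : ℕ) + 1)) + (∑ r, αB r / (m : ℝ) ^ (2 * (r : ℕ) + 2)))) ^ 2 = (Fmode m / π * (∑ j, αA j / (m : ℝ) ^ (2 * (j : ℕ) + 1)) + (∑ r, αB r / (m : ℝ) ^ (2 * (r : ℕ) + 2))) ^ 2 := by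
        rw [mul_pow, ← pow_mul, Even.neg_one_pow (by exact ⟨m, by ring⟩), one_mul]
      rw [hsgn] at hpp
      have h2 : 0 ≤ 1 + θ⁻¹ := by positivity
      exact hpp.trans (add_le_add le_rfl (mul_le_mul_of_nonneg_left hRsq h2))
    have hnn : 0 ≤ (∑ i, bcol m i * x i) ^ 2 := sq_nonneg _
    calc (∑ i, bcol m i * x i) ^ 2 / d m
        ≤ (∑ i, bcol m i * x i) ^ 2 / w m := div_le_div_of_nonneg_left hnn hwpos hwm.2
      _ ≤ ((1 + θ) * (Fmode m / π * (∑ j, αA j / (m : ℝ) ^ (2 * (j : ℕ) + 1)) + (∑ r, αB r / (m : ℝ) ^ (2 * (r : ℕ) + 2))) ^ 2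
          + (1 + θ⁻¹) * ((B : ℝ) * (∑ i, ρ i ^ 2 * x i ^ 2) * (1 / ((m : ℝ) ^ (2 * J + 1)) ^ 2))) / w m := div_le_div_of_nonneg_right hsq hwpos.le
      _ = _ := by
          field_simp
  -- sum over the middle range
  have step1 : ∑ m ∈ T, (∑ i, bcol m i * x i) ^ 2 / d m
      ≤ (1 + θ) * ∑ m ∈ T, (Fmode m / π * (∑ j, αA j / (m : ℝ) ^ (2 * (j : ℕ) + 1)) + (∑ r, αB r / (m : ℝ) ^ (2 * (r : ℕ) + 2))) ^ 2 / w m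
        + (1 + θ⁻¹) * (B : ℝ) * (∑ i, ρ i ^ 2 * x i ^ 2) * ∑ m ∈ T, (1 / ((m : ℝ) ^ (2 * J + 1))) ^ 2 / w m := by
    refine (Finset.sum_le_sum key).trans (le_of_eq ?_)
    simp only [Finset.sum_add_distrib, ← Finset.mul_sum]
  -- the structured sum, exactly, as four blocks
  have hpoly : ∀ m ∈ T, (Fmode m / π * (∑ j, αA j / (m : ℝ) ^ (2 * (j : ℕ) + 1)) + (∑ r, αB r / (m : ℝ) ^ (2 * (r : ℕ) + 2))) ^ 2 / w m
      = ((∑ j, αA j * (Fmode m / π / (m : ℝ) ^ (2 * (j : ℕ) + 1)))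
          + ∑ r', αB r' * (1 / (m : ℝ) ^ (2 * (r' : ℕ) + 2))) ^ 2 / w m := by
    intro m _
    rw [modePoly_eq_sum_mul]
  rw [Finset.sum_congr rfl hpoly, sum_sq_add_div_eq] at step1
  refine step1.trans (le_of_eq ?_)
  rw [dotProduct_mulVec_eq_sum_sum]
  simp only [Matrix.of_apply]
  rw [sum_sum_mul_skeletonMJ_eq, sum_sum_mul_gram2_eq, sum_sum_mul_gram2_eq, sum_sum_mul_gram2_eq, sum_sum_mul_gram2_eq]

end Middle

end Summit.RiemannHypothesis.RiemannHypothesis.Theorems.WeilFormatC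

end
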